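import Summits.Ventures.PackingBounds.Configurations.CL18Pairs
import Summits.Ventures.PackingBounds.Kissing.DimensionEighteen

/-!
# Cohn–Li in dimension `18`, V: `κ(18) ≥ 7654` in Lean

Framing: lottery ticket; floor = certified bounds/negative ranges. Venture `PackingBounds` (cell
`pub-packcert`, seat `pub-packcert-energy`).

The `7654` integer vectors `cl18Int ⊂ ℤ²⁴` (`CL18Count.lean`) have norm `288` and pairwise inner products `≤ 144`
(`CL18Pairs.lean`) and lie in the `18`-dimensional subspace `{y₁₆ = y₁₇, y₁₈ = 2y₁₉ = 2y₂₀, y₂₁ = y₂₂ = y₂₃ = 0}`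
of `ℝ²⁴`, cut out by six INTEGER normals `nu i` (`e₁₆ − e₁₇`, `e₁₈ − e₁₉ − e₂₀`, `e₁₉ − e₂₀`, `e₂₁`, `e₂₂`, `e₂₃`,
pairwise orthogonal — all checked by `decide` on `ip`). Scaling by `1/√288` and transferring
(`Config.exists_transfer_orthogonal`) gives **a kissing configuration of `7654` unit vectors in `ℝ¹⁸`**:
`κ(18) ≥ 7654` (Cohn–Li 2024, Theorem 1.1 — the record lower bound in dimension `18` at the time of writing), as a
kernel-checked theorem (`exists_kissing_7654`); with the cell's Delsarte LP certificate, `7654 ≤ κ(18) ≤ 17877`.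

## References
* H. Cohn, A. Li, *Improved kissing numbers in seventeen through twenty-one dimensions*, arXiv:2411.04916 (2024), Thm. 1.1, §4. [`CohnLi2024`]
* J. H. Conway, N. J. A. Sloane, *Sphere Packings, Lattices and Groups*, Ch. 1 Table 1.2. [`ConwaySloane1999`]
-/

namespace Summit.Ventures.PackingBounds.Config.CL17

open Finset Leech Golay

/-! ### Every vector is a two-axis pattern vector; norms -/

/-- A one-axis pattern vector is a two-axis one with `g = 0`. -/
theorem pvec_eq_qvec (S : Finset (Fin 24)) (f : Fin 24 → Bool) (a e : ℤ) : pvec S f a e = qvec S f a e 0 := by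
  funext j
  simp [qvec, axis6]

/-- Every vector of the configuration is a two-axis pattern vector on cells, of norm `288`. -/
theorem exists_qvec_of_mem18 {x : Fin 24 → ℤ} (hx : x ∈ cl18Int) :
    ∃ S : Finset (Fin 24), ∃ f : Fin 24 → Bool, ∃ a e g : ℤ, S ⊆ cells ∧ x = qvec S f a e g ∧ ip x x = 288 := by
  rcases mem_cl18Int hx with hx | hx | hx | hx
  · obtain ⟨k, l, a, b, ⟨hkl, hl⟩, rfl⟩ := mem_setA18.mp hx
    refine ⟨_, _, _, _, _, pair_sub (lt_trans hkl hl) hl, by rw [aV18, pvec_eq_qvec], ?_⟩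
    rw [aV18, ip_pvec_self (pair_sub (lt_trans hkl hl) hl), card_pair (ne_of_lt hkl)]; norm_num
  · obtain ⟨i, hi, f, c, -, rfl⟩ := exists_of_mem_setO hx
    obtain ⟨-, -, -, -, -, -, -, hn, -, -⟩ := wd_facts i hi
    refine ⟨_, _, _, _, _, supp_wd_sub hi, rfl, ?_⟩
    rw [ip_qvec_self (supp_wd_sub hi), card_supp_eq_popK, ← hn, kO]
    have h1 : sgn c * sgn c = 1 := by rcases sgn_cases c with h | h <;> rw [h] <;> norm_num
    linear_combination (2 * eT i * eT i + 6 * gT i * gT i) * h1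
  · rw [setW, mem_union] at hx
    rcases hx with hx | hx
    · obtain ⟨c, rfl⟩ := mem_setT18.mp hx
      refine ⟨_, _, _, _, _, Finset.empty_subset _, rfl, ?_⟩
      rw [ip_qvec_self (Finset.empty_subset _), Finset.card_empty]
      rcases sgn_cases c with h | h <;> rw [h] <;> norm_num
    · obtain ⟨c, c', rfl⟩ := mem_setU.mp hx
      refine ⟨_, _, _, _, _, Finset.empty_subset _, rfl, ?_⟩
      rw [ip_qvec_self (Finset.empty_subset _), Finset.card_empty]
      rcases sgn_cases c with h | h <;> rcases sgn_cases c' with h' | h' <;> rw [h, h'] <;> norm_num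
  · obtain ⟨m, _, rfl⟩ := mem_setD18.mp hx
    refine ⟨_, _, _, _, _, subset_rfl, rfl, ?_⟩
    rw [ip_qvec_self subset_rfl, card_cells]
    rcases sgn_cases (chi (c8 m)) with h | h <;> rw [h] <;> norm_num

/-- Every vector of the configuration has norm `288`. -/
theorem ip_self_of_mem18 {x : Fin 24 → ℤ} (hx : x ∈ cl18Int) : ip x x = 288 := by
  obtain ⟨_, _, _, _, _, _, _, h⟩ := exists_qvec_of_mem18 hx
  exact h

/-! ### The six integer normals -/

/-- The six integer normals of the subspace `{y₁₆ = y₁₇, y₁₈ = 2y₁₉ = 2y₂₀, y₂₁ = y₂₂ = y₂₃ = 0}`: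
`e₁₆ − e₁₇`, `e₁₈ − e₁₉ − e₂₀`, `e₁₉ − e₂₀`, `e₂₁`, `e₂₂`, `e₂₃`. -/
def nu (i : Fin 6) (j : Fin 24) : ℤ :=
  if i.val = 0 then (if j.val = 16 then 1 else if j.val = 17 then -1 else 0)
  else if i.val = 1 then (if j.val = 18 then 1 else if j.val = 19 then -1 else if j.val = 20 then -1 else 0)
  else if i.val = 2 then (if j.val = 19 then 1 else if j.val = 20 then -1 else 0)
  else if j.val = 18 + i.val then 1 else 0

/-- The normals are pairwise orthogonal, nonzero, vanish on the cells, and annihilate both axes (kernel check). -/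
theorem nu_facts : (∀ i i' : Fin 6, i ≠ i' → ip (nu i) (nu i') = 0) ∧ (∀ i : Fin 6, ip (nu i) (nu i) ≠ 0) ∧
    (∀ i : Fin 6, (∀ j : Fin 24, j.val < 16 → nu i j = 0) ∧ nu i 16 + nu i 17 = 0 ∧
      2 * nu i 18 + nu i 19 + nu i 20 = 0) := by
  refine ⟨by decide, by decide, by decide⟩

/-- A normal annihilates every two-axis pattern vector on cells. -/
theorem ip_nu_qvec (i : Fin 6) {S : Finset (Fin 24)} (hS : S ⊆ cells) (f : Fin 24 → Bool) (a e g : ℤ) :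
    ip (nu i) (qvec S f a e g) = 0 := by
  obtain ⟨hcell, h16, h18⟩ := nu_facts.2.2 i
  rw [qvec, ip_add_right, ip_pvec, ip_axis6]
  have h0 : ∑ j ∈ S, nu i j * (a * sgn (f j)) = 0 :=
    Finset.sum_eq_zero fun j hj => by rw [hcell j (mem_cells.mp (hS hj)), zero_mul]
  rw [h0]
  linear_combination e * h16 + g * h18

/-! ### The configuration in `ℝ²⁴` and its transfer to `ℝ¹⁸` -/

/-- **The Cohn–Li `18`-dimensional kissing configuration**, normalised, inside `ℝ²⁴`.
[cite: CohnLi2024, Thm. 1.1, §4] -/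
noncomputable def cl18 : Finset (EuclideanSpace ℝ (Fin 24)) := cl18Int.image (toE 288)

/-- `|cl18| = 7654`. -/
theorem card_cl18 : cl18.card = 7654 := by
  rw [cl18, card_image_of_injective _ (toE_injective (by norm_num)), card_cl18Int]

/-- Unit vectors. -/
theorem norm_cl18 : ∀ p ∈ cl18, ‖p‖ = 1 := by
  intro p hp
  obtain ⟨x, hx, rfl⟩ := mem_image.mp hp
  exact norm_toE (by norm_num) (by rw [ip_self_of_mem18 hx]; norm_num)

/-- Pairwise inner products `≤ 1/2`. -/
theorem inner_cl18 : ∀ a ∈ cl18, ∀ b ∈ cl18, a ≠ b → inner ℝ a b ≤ 1 / 2 := by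
  intro a ha b hb hab
  obtain ⟨x, hx, rfl⟩ := mem_image.mp ha
  obtain ⟨y, hy, rfl⟩ := mem_image.mp hb
  have hxy : x ≠ y := fun h => hab (by rw [h])
  rw [inner_toE (by norm_num), div_le_iff₀ (by norm_num)]
  have h : (ip x y : ℝ) ≤ 144 := by exact_mod_cast ip_le_of_mem18 hx hy hxy
  linarith

/-- The normals, as vectors of `ℝ²⁴`. -/
noncomputable def nrm18 (i : Fin 6) : EuclideanSpace ℝ (Fin 24) := toE 1 (nu i)

/-- The configuration is orthogonal to the normals. -/
theorem inner_nrm18_cl18 (i : Fin 6) : ∀ p ∈ cl18, inner ℝ (nrm18 i) p = 0 := by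
  intro p hp
  obtain ⟨x, hx, rfl⟩ := mem_image.mp hp
  obtain ⟨S, f, a, e, g, hS, rfl, -⟩ := exists_qvec_of_mem18 hx
  rw [nrm18, inner_toE_toE (by norm_num) (by norm_num), ip_nu_qvec i hS]
  simp

/-- The normals are linearly independent (pairwise orthogonal and nonzero). -/
theorem linearIndependent_nrm18 : LinearIndependent ℝ nrm18 := by
  obtain ⟨horth, hnz, -⟩ := nu_facts
  apply linearIndependent_of_ne_zero_of_inner_eq_zero
  · intro i h
    have h1 : inner ℝ (nrm18 i) (nrm18 i) = 0 := by rw [h, inner_zero_left]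
    rw [nrm18, inner_toE (by norm_num), div_eq_zero_iff] at h1
    rcases h1 with h1 | h1
    · exact hnz i (by exact_mod_cast h1)
    · norm_num at h1
  · intro i j hij
    rw [nrm18, nrm18, inner_toE (by norm_num), horth i j hij]
    simp

/-! ### The theorems -/

/-- **`κ(18) ≥ 7654`** (Cohn–Li 2024, Theorem 1.1): a kissing configuration of `7654` unit vectors in `ℝ¹⁸`. -/
theorem exists_kissing_7654 : ∃ C : Finset (EuclideanSpace ℝ (Fin 18)),
    C.card = 7654 ∧ (∀ x ∈ C, ‖x‖ = 1) ∧ (∀ x ∈ C, ∀ y ∈ C, x ≠ y → inner ℝ x y ≤ 1 / 2) := by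
  obtain ⟨C', hc, hno, hi, _⟩ := exists_transfer_orthogonal (m := 24) (n := 18) (k := 6) (by norm_num)
    nrm18 linearIndependent_nrm18 cl18 (fun x hx i => inner_nrm18_cl18 i x hx)
  refine ⟨C', by rw [hc, card_cl18], fun x' hx' => ?_, fun x' hx' y' hy' hne => ?_⟩
  · obtain ⟨x, hx, he⟩ := hno x' hx'
    rw [he]; exact norm_cl18 x hx
  · obtain ⟨x, hx, y, hy, hxy, he⟩ := hi x' hx' y' hy' hne
    rw [he]; exact inner_cl18 x hx y hy hxy

/-- **`7654 ≤ κ(18) ≤ 17877` in Lean** (explicit Cohn–Li configuration; Delsarte LP certificate of the cell). -/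
theorem kissing_dim18_bracket :
    (∃ C : Finset (EuclideanSpace ℝ (Fin 18)), C.card = 7654 ∧ (∀ x ∈ C, ‖x‖ = 1) ∧
      (∀ x ∈ C, ∀ y ∈ C, x ≠ y → inner ℝ x y ≤ 1 / 2)) ∧
    ∀ C : Finset (EuclideanSpace ℝ (Fin 18)), (∀ x ∈ C, ‖x‖ = 1) →
      (∀ x ∈ C, ∀ y ∈ C, x ≠ y → inner ℝ x y ≤ 1 / 2) → C.card ≤ 17877 :=
  ⟨exists_kissing_7654, Kissing.kissing_dim18_le_17877⟩

end Summit.Ventures.PackingBounds.Config.CL17
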